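import Mathlib.Analysis.Distribution.SchwartzSpace.Basic
import Literature.Analysis.FluidPDE.VectorCalculus
import Literature.Analysis.FluidPDE.MildSolution
import Literature.Analysis.FluidPDE.TaoAveragedEuler
import Literature.Analysis.FluidPDE.TaoAveragedSobolev
import HarnessLib

-- provenance: harness21/H21/H21/Statements/NS/TaoAveraged.lean @ 6f56c34 (interim HEAD d8f2665); M5 mechanical rewrite
/-!
# Tao's finite time blow-up for an averaged Navier–Stokes equation — function-level rendering

(family: NS, statement **ns.S17**; trunk FluidKinetic, outline `H21/Outlines/FluidKinetic.md`,
item `NSTaoAveraged`.)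

Physical space is `ℝ³ = EuclideanSpace ℝ (Fin 3)`, viscosity `ν = 1`, no force. Source: T. Tao,
*Finite time blowup for an averaged three-dimensional Navier–Stokes equation*, J. Amer. Math.
Soc. 29 (2016), 601–674 = arXiv:1402.0290v3 (held as `paper:arxiv-1402.0290`; all numbers below are
those of that text): §1.1, Conj. 1.2, (1.9)–(1.16), Remark 1.4, **Theorem 1.5** (p. 9).

* **ns.S17** (Tao 2016, Thm. 1.5): there exist a symmetric averaged Euler bilinear operator `B̃`
  (an average (1.12)/(1.13) of copies of the Euler bilinear form `B(u,v) = -½ P[(u·∇)v + (v·∇)u]`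
  conjugated by random real order-`0` Fourier multipliers, rotations in `SO(3)` and dilations
  `Dil_λ u (x) = λ^{3/2} u(λx)` (1.11)) obeying the cancellation property `⟨B̃(u,u), u⟩ = 0`
  (1.16), and a Schwartz divergence-free `u₀`, such that there is **no** global mild solution
  `u : [0, ∞) → H¹⁰_df(ℝ³)` of the averaged Navier–Stokes equation `∂ₜu = Δu + B̃(u,u)`,
  `u(0) = u₀` ((1.9), mild solutions (1.15)).

## Verdict clean-up (2026-08-15): the two closed facts of this file are MIS-STATED and deprecated

This file renders Thm. 1.5 over the accepted *function-level* prelude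
`Literature/Analysis/FluidPDE/TaoAveragedEuler.lean` (`TaoAverageData`, `multiplierApply`,
`IsAveragedEulerBilinear`, `HasCancellation`, `IsAveragedNSMildSolutionOn`). Its two closed named
facts, `tao_averaged_ns_blowup` and `exists_not_averagedNSGlobalRegularity`, were found by their
prove-seats (2026-08-14/15) **not to be the printed theorem**, and re-reading the source confirms it:

1. *Symbol class (decisive).* Tao's "real Fourier multipliers of order `0`" (the class `𝓜₀`,
   §1.1 p. 6) have **complex** symbols `m : ℝ³ → ℂ`, smooth off the origin with all seminorms
   (1.10) finite, subject to the reality condition `m(-ξ) = \overline{m(ξ)}`; such symbols have an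
   even real part *and an odd imaginary part*, and the proof of Thm. 1.5 uses the odd ones (§3.1,
   p. 15: a complex average is split into `2³` real pieces "by taking real parts", the surviving
   real multipliers being the Hermitian parts `m₁ = (m + \overline{m(-·)})/2`,
   `m₂ = (m - \overline{m(-·)})/2i`). The prelude's `TaoAverageData.m : Fin 3 → Ω → ℝ³ → ℝ` is
   real-valued and `multiplierApply m u = Re 𝓕⁻(m û)` keeps exactly the even part of `m`, so
   `IsAveragedEulerBilinear` ranges over averages with **even real** symbols only — a class that
   does not contain Tao's. An `∃ B, IsAveragedEulerBilinear B ∧ …` statement is therefore not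
   implied by Thm. 1.5, and Tao's own witness (the local cascade operator `C` of §4, (4.1), built
   from Schwartz `ψᵢ` "with Fourier transform real-valued", hence even `ψᵢ`) satisfies
   `C(Pu, Pv) = -P C(u, v)` for the parity `P u (x) = -u(-x)`, whereas every operator of the
   accepted class commutes with `P` on honest inputs (computation recorded in the module docstring
   of `Literature/Analysis/FluidPDE/TaoAveragedProofs.lean`): the printed proof yields no witness
   in the accepted class, and no other source is known. (In the other direction the accepted class
   is *wider* than Tao's — any linear isometry instead of `SO(3)`, free exponent `σ` instead of
   `3/2`, no bounds `C⁻¹ ≤ λ ≤ C`, no moment bounds `𝔼 ‖m₁‖_{k₁}‖m₂‖_{k₂}‖m₃‖_{k₃} < ∞` — which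
   alone would only weaken an existence statement.)
2. *Solution concept.* Tao's `B̃ : H¹⁰_df × H¹⁰_df → (H¹⁰_df)*` is defined by duality
   ((1.12)–(1.13)) and a mild solution is a continuous map `u : I → H¹⁰_df(ℝ³)` obeying (1.15) in
   that space; the prelude pins `B = 𝒜.op` on *all* everywhere-defined fields through pointwise
   Bochner/Fourier surrogates (documented there as junk `0` off `L¹`), so "no `u : ℝ → ℝ³ → ℝ³`
   with `IsGlobalH10MildSolution B u₀ u`" is a different assertion, neither implied by nor
   implying the printed one.
3. *Locators.* The main theorem is Thm. **1.5** (the interim text said "1.4", the arXiv v1–v2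
   number); the dilation is (1.11) with exponent `3/2` (this settles the prelude's "`σ` unverified"
   flag: `σ = 3/2` at source), the averaged operator is (1.12)/(1.13), mild solutions are (1.15),
   the cancellation property is (1.16).

**The printed theorem is in the tree**: `Literature.Analysis.FluidPDE.Tao2016.averagedNS_blowup`
(`Literature/Analysis/FluidPDE/TaoAveragedSobolev.lean`: `L²`-valued fields, `H¹⁰_df` via the
Fourier–Sobolev norm, complex Hermitian order-`0` symbols with moment bounds, `SO(3)`, `λ^{3/2}`,
`λ ∈ [C⁻¹, C]`, duality form (1.13), mild solutions (1.15)), with the corollary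
`Literature.Analysis.FluidPDE.Tao2016.exists_not_globalRegularity` ("global regularity fails for
some symmetric averaged operator with cancellation"). Accordingly (human ruling 2026-08-15:
restate, do not delete) the two closed facts below are `@[deprecated]` in favour of those
declarations and keep their bodies verbatim for their remaining users
(`Literature/Analysis/FluidPDE/TaoAveragedProofs.lean`, the barrier entry
`Literature.Barriers.NavierStokesRegularity.TaoAveragedBlowup`); the *notions* of this file
(`ContinuousInH10On`, `IsGlobalH10MildSolution`, `AveragedNSGlobalRegularity`, used by
`Summits/NavierStokesRegularity/…/Theorems/MonotoneCriticalInterfaceAveraged.lean`) are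
unchanged. Route items phrased over the accepted function-level class (e.g. the negative companion
of `Summits/NavierStokesRegularity/NavierStokesRegularity/Theses/MonotoneCritical.lean`) should be
fed `Tao2016.averagedNS_blowup`, not the deprecated facts.

## Conventions recalled from the prelude

* The averaged operators, the cancellation property, the class `H¹⁰_df` and mild solutions are
  the accepted `IsAveragedEulerBilinear`, `HasCancellation`, `MemH10DivFree`,
  `IsAveragedNSMildSolutionOn` (`Literature/Analysis/FluidPDE/TaoAveragedEuler.lean`).
* **`t = 0`.** Mild solutions are written with the accepted `heatFlow` (`e^{0Δ} = id`), so the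
  `t = 0` clause of `IsAveragedNSMildSolutionOn (Ici 0) B u₀ u` is literally `u 0 = u₀`
  (accepted `isAveragedNSMildSolutionOn_zero_iff`; recorded below as
  `IsGlobalH10MildSolution.initial`).
* **Continuity in time in `H¹⁰`** (Tao (1.15): `u : I → H¹⁰_df` continuous) is the predicate
  `ContinuousInH10On`: `∑_{n ≤ 10} ‖∇ⁿ(u t − u t₀)‖_{L²} → 0` as `t → t₀` within the time set,
  the `H¹⁰` twin of the accepted `ContinuousInLpOn`.
* **Junk.** The accepted function-level operators are honest on Schwartz divergence-free fields
  and Bochner-junk elsewhere (see the prelude's module docstring and item 2 above).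

## Mathlib / tree search

Mathlib has the Schwartz space `𝓢(E, F)` (`Mathlib/Analysis/Distribution/SchwartzSpace/`),
`iteratedFDeriv`, `MeasureTheory.eLpNorm`, `nhdsWithin`; it has nothing on Navier–Stokes,
Fourier multipliers of order `0` on functions, or Tao's construction (searched `NavierStokes`,
`averaged`, `Mikhlin`, `multiplier`). Everything specific comes from the accepted prelude
(`IsDivFree`, `heatFlow`, `TaoAveragedEuler`) and, for the printed statement, from
`TaoAveragedSobolev.lean`.

## References

* T. Tao, *Finite time blowup for an averaged three-dimensional Navier–Stokes equation*,
  J. Amer. Math. Soc. 29 (2016), 601–674 = arXiv:1402.0290v3: §1.1 (Conj. 1.2, p. 6 the class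
  `𝓜₀`, (1.9)–(1.16), Rem. 1.4, Thm. 1.5), §3.1 (p. 15), §4 ((4.1)). Key `Tao2016AveragedNS`
  (= interim keys `Tao2016`, `arXiv14020290`).
* C. Fefferman, *Existence and smoothness of the Navier–Stokes equation*, Clay Millennium
  Problem description (2000), statement (A) (global regularity for Schwartz data) — Tao's
  Conj. 1.1, equivalent to the mild form Conj. 1.2 by his Lemma 1.3.
-/

noncomputable section

open MeasureTheory Set Function Filter Topology
open scoped ENNReal NNReal SchwartzMap InnerProductSpace RealInnerProductSpace

namespace Literature.Analysis.FluidPDE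

/-- Local notation for physical space `ℝ³ = EuclideanSpace ℝ (Fin 3)`. -/
local notation "ℝ³" => EuclideanSpace ℝ (Fin 3)

section NS

/-! ## The solution class of Tao's (1.15), function-level -/

/-- **Continuity in time with values in `H¹⁰(ℝ³)`** on a time set `S`: for every `t₀ ∈ S`,
`∑_{n ≤ 10} ‖∇ⁿ(u t − u t₀)‖_{L²(ℝ³)} → 0` as `t → t₀` within `S` (Tao 2016, (1.15): a mild
solution is "a continuous map `u : I → H¹⁰_df(ℝ³)`"). The `H¹⁰` twin of the accepted
`ContinuousInLpOn`, for everywhere-defined `C¹⁰` fields; the pointwise membership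
`u t ∈ H¹⁰_df` is imposed separately through the accepted `MemH10DivFree`. (The `L²`-class
version over the Fourier–Sobolev norm is `Tao2016.ContinuousInH10On`.) [cite: Tao2016AveragedNS, §1.1 (1.15)] -/
def ContinuousInH10On (S : Set ℝ) (u : ℝ → ℝ³ → ℝ³) : Prop :=
  ∀ t₀ ∈ S, Tendsto
    (fun t => ∑ n ∈ Finset.range 11,
      eLpNorm (iteratedFDeriv ℝ n (u t - u t₀)) 2 (volume : Measure ℝ³))
    (𝓝[S] t₀) (𝓝 0)

/-- `ContinuousInH10On` is monotone in the time set. [folklore] -/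
theorem ContinuousInH10On.mono {S S' : Set ℝ} {u : ℝ → ℝ³ → ℝ³}
    (hu : ContinuousInH10On S u) (h : S' ⊆ S) : ContinuousInH10On S' u :=
  fun t₀ ht₀ => (hu t₀ (h ht₀)).mono_left (nhdsWithin_mono _ h)

/-- **Global mild solutions in `H¹⁰_df`, function-level** (after Tao 2016, (1.15) with
`I = [0, ∞)`): `u` is a *global-in-time mild solution* of `∂ₜu = Δu + B(u,u)` with datum `u₀`
if `u t ∈ H¹⁰_df(ℝ³)` for all `t ≥ 0` (accepted `MemH10DivFree`: a `C¹⁰` representative with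
square-integrable derivatives, divergence free), `u ∈ C([0,∞); H¹⁰)` (`ContinuousInH10On`), and
the pointwise Duhamel identity `u t x = (e^{tΔ}u₀)(x) + ∫₀ᵗ (e^{(t-s)Δ} B(u s, u s))(x) ds`
holds for all `t ≥ 0` (accepted `IsAveragedNSMildSolutionOn (Ici 0)`; at `t = 0` it reads
`u 0 = u₀`). This is the function-level surrogate of Tao's notion (a continuous
`u : [0,∞) → H¹⁰_df` obeying (1.15) in `(H¹⁰_df)*`, in the tree as
`Tao2016.AveragingDatum.IsMildSolution`); the two agree only where the operator `B` fed to it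
is honest (module docstring, item 2). [cite: Tao2016AveragedNS, §1.1 (1.15)] -/
def IsGlobalH10MildSolution (B : (ℝ³ → ℝ³) → (ℝ³ → ℝ³) → ℝ³ → ℝ³) (u₀ : ℝ³ → ℝ³)
    (u : ℝ → ℝ³ → ℝ³) : Prop :=
  (∀ t : ℝ, 0 ≤ t → FluidPDE.MemH10DivFree (u t)) ∧ ContinuousInH10On (Ici 0) u ∧
    FluidPDE.IsAveragedNSMildSolutionOn (Ici 0) B u₀ u

/-- A global `H¹⁰_df` mild solution attains its datum: `u 0 = u₀` (the `t = 0` clause of the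
Duhamel identity, accepted `isAveragedNSMildSolutionOn_zero_iff`; review finding 1 of the
outline). [folklore] -/
theorem IsGlobalH10MildSolution.initial {B : (ℝ³ → ℝ³) → (ℝ³ → ℝ³) → ℝ³ → ℝ³} {u₀ : ℝ³ → ℝ³}
    {u : ℝ → ℝ³ → ℝ³} (h : IsGlobalH10MildSolution B u₀ u) : u 0 = u₀ :=
  (FluidPDE.isAveragedNSMildSolutionOn_zero_iff B u₀ u).1
    (h.2.2.mono (singleton_subset_iff.2 (mem_Ici.2 le_rfl)))

/-- In particular the datum of a global `H¹⁰_df` mild solution lies in `H¹⁰_df`. [folklore] -/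
theorem IsGlobalH10MildSolution.memH10DivFree_initial
    {B : (ℝ³ → ℝ³) → (ℝ³ → ℝ³) → ℝ³ → ℝ³} {u₀ : ℝ³ → ℝ³} {u : ℝ → ℝ³ → ℝ³}
    (h : IsGlobalH10MildSolution B u₀ u) : FluidPDE.MemH10DivFree u₀ :=
  h.initial ▸ h.1 0 le_rfl

/-- **Global regularity for the averaged Navier–Stokes equation driven by `B`, function-level**
(the analogue of Tao's Conj. 1.2 — the mild form of Clay (A) — for his averaged equation (1.9)):
every Schwartz divergence-free datum `u₀` admits a global-in-time mild solution
`u : [0,∞) → H¹⁰_df(ℝ³)` of `∂ₜu = Δu + B(u,u)`, `u(0) = u₀`, in the function-level sense of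
`IsGlobalH10MildSolution`. A `Prop`-valued predicate on `B` (not asserted); its `L²`/duality
counterpart over Tao's own class is `Tao2016.GlobalRegularity`. [cite: Tao2016AveragedNS, §1.1 Conj. 1.2 and (1.9)] -/
def AveragedNSGlobalRegularity (B : (ℝ³ → ℝ³) → (ℝ³ → ℝ³) → ℝ³ → ℝ³) : Prop :=
  ∀ u₀ : ℝ³ → ℝ³, FluidPDE.IsSchwartzField u₀ → VectorCalculus.IsDivFree u₀ →
    ∃ u : ℝ → ℝ³ → ℝ³, IsGlobalH10MildSolution B u₀ u

/-! ## ns.S17: the deprecated function-level renderings of Tao's Theorem 1.5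

The printed theorem is `Tao2016.averagedNS_blowup` (`TaoAveragedSobolev.lean`); see the module
docstring, *Verdict clean-up*. -/

/-- **Deprecated** (verdict clean-up 2026-08-15) — **mis-stated**; superseded by
`Literature.Analysis.FluidPDE.Tao2016.averagedNS_blowup` (`TaoAveragedSobolev.lean`), Tao's
Theorem 1.5 as printed. *What is wrong:* the body quantifies over the accepted function-level
class `IsAveragedEulerBilinear`, whose random symbols `TaoAverageData.m` are real-valued and of
which `multiplierApply` keeps only the even part, whereas Tao's real order-`0` multipliers `𝓜₀`
(J. Amer. Math. Soc. 29 (2016) = arXiv:1402.0290v3, §1.1 p. 6) have complex symbols with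
`m(-ξ) = \overline{m(ξ)}` — odd imaginary parts allowed and used in the proof (§3.1, p. 15) — so
this existence statement over a class not containing Tao's is **not implied by Thm. 1.5**; Tao's
witness (the cascade operator `C` of §4, (4.1), with real-valued `ψ̂ᵢ`) is parity-anti-covariant
and lies outside the accepted (parity-covariant) class; and the solution concept is the pointwise
Bochner/Fourier surrogate `IsGlobalH10MildSolution` of (1.15) rather than Tao's duality-defined
`B̃` on `H¹⁰_df` (module docstring, items 1–2). No source proves or refutes the body as it
stands, so no `_holds` theorem can land. Kept verbatim (statement unchanged) for its remaining
users `exists_not_averagedNSGlobalRegularity_of_blowup` (`TaoAveragedProofs.lean`) and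
`Literature.Barriers.NavierStokesRegularity.TaoAveragedBlowup`; do not use in new code.
*Original content* — **ns.S17** as rendered here: there exist `B` with
`IsAveragedEulerBilinear B`, `B u v = B v u`, `HasCancellation B`, and a Schwartz divergence-free
`u₀ : ℝ³ → ℝ³` with no `u : ℝ → ℝ³ → ℝ³` satisfying `IsGlobalH10MildSolution B u₀ u`.
[cite: Tao2016AveragedNS, §1.1 Thm. 1.5 as mis-rendered here (even real symbol class, function-level solution concept) — corrected statement: Tao2016.averagedNS_blowup (TaoAveragedSobolev.lean)] -/
@[deprecated Literature.Analysis.FluidPDE.Tao2016.averagedNS_blowup (since := "2026-08-15")]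
def tao_averaged_ns_blowup : Prop :=
  ∃ B : (ℝ³ → ℝ³) → (ℝ³ → ℝ³) → ℝ³ → ℝ³,
      FluidPDE.IsAveragedEulerBilinear B ∧ (∀ u v, B u v = B v u) ∧ FluidPDE.HasCancellation B ∧
        ∃ u₀ : ℝ³ → ℝ³, FluidPDE.IsSchwartzField u₀ ∧ VectorCalculus.IsDivFree u₀ ∧
          ¬ ∃ u : ℝ → ℝ³ → ℝ³, IsGlobalH10MildSolution B u₀ u

/-- **Deprecated** (verdict clean-up 2026-08-15) — **mis-stated**; superseded by
`Literature.Analysis.FluidPDE.Tao2016.exists_not_globalRegularity` (`TaoAveragedSobolev.lean`: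
global regularity, `Tao2016.GlobalRegularity 𝒜`, fails for some symmetric averaging datum with
the cancellation property — Thm. 1.5 reformulated, proved there from `Tao2016.averagedNS_blowup`
by `Tao2016.exists_not_globalRegularity_of_blowup`). *What is wrong:* the same two defects as
`tao_averaged_ns_blowup`, of which this is the symmetry-free corollary — the accepted class
`IsAveragedEulerBilinear` has real-valued (effectively even) symbols while Tao's `𝓜₀` (§1.1 p. 6)
is complex Hermitian, so Thm. 1.5 does not imply an existence statement over it (Tao's witness
`C` of §4 is provably outside the class), and `AveragedNSGlobalRegularity` is the function-level
surrogate of the mild-solution notion (1.15). Kept verbatim (statement unchanged) for its users in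
`TaoAveragedProofs.lean` and `Literature.Barriers.NavierStokesRegularity.TaoAveragedBlowup`; do not
use in new code. *Original content:* there exists `B` with `IsAveragedEulerBilinear B` and
`HasCancellation B` such that `¬ AveragedNSGlobalRegularity B` (Tao 2016, Thm. 1.5 and the
discussion of §1.1, pp. 5 and 9–10: any proof of Conj. 1.1/1.2 "must use finer structure" of the
nonlinearity than the harmonic-analysis estimates and the energy identity shared by all `B̃`).
[cite: Tao2016AveragedNS, §1.1 Thm. 1.5 as mis-rendered here (even real symbol class, function-level solution concept) — corrected statement: Tao2016.exists_not_globalRegularity (TaoAveragedSobolev.lean)] -/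
@[deprecated Literature.Analysis.FluidPDE.Tao2016.exists_not_globalRegularity
  (since := "2026-08-15")]
def exists_not_averagedNSGlobalRegularity : Prop :=
  ∃ B : (ℝ³ → ℝ³) → (ℝ³ → ℝ³) → ℝ³ → ℝ³,
      FluidPDE.IsAveragedEulerBilinear B ∧ FluidPDE.HasCancellation B ∧
        ¬ AveragedNSGlobalRegularity B

/- interim proof relied on results that are now named facts (D-0014); demoted to a fact by the M5 import, proof preserved
(and now proved, over the deprecated names, as `exists_not_averagedNSGlobalRegularity_of_blowup` in `TaoAveragedProofs.lean`):
:= by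
  obtain ⟨B, hB, -, hC, u₀, hu₀, hdiv, hno⟩ := tao_averaged_ns_blowup
  exact ⟨B, hB, hC, fun h => hno (h u₀ hu₀ hdiv)⟩
-/

end NS

end Literature.Analysis.FluidPDE
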